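import Mathlib

/-!
# `MatrixDescartes` census — kit lemma for PIECEWISE chamber certificates: «one of twenty reals is minimal», as a 20-way disjunction

HONEST FRAMING.  Object-search cell `pub-symmetroid`, door-A target `DoorA26 := PosRootLawAt 2 6 19` (stmt-ValiantsHypothesis-19979; OPEN,
typed, never asserted).  Pure bookkeeping for the val-sym-door-p2 g4 «fan» (piecewise-multiplier) chamber certificates: the case split
«some normalised gap is the smallest» over a finite set of the twenty gap positions, stated with NUMERAL indices so that generated files can
read off concrete inequalities by `simp only [Matrix.cons_val]`.  Nothing here is about pencils; nothing bears on `DoorA26` (OPEN), the crux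
`MatrixDescartes` (stmt-ValiantsHypothesis-18050) or `VP ≠ VNP`.

[folklore] `Finset.exists_min_image`; elementary.
-/

-- `Summit.ValiantsHypothesis.ValiantsHypothesis.…` repeats a component by the D-0017 layout
-- (single-conjunct summit), which the `dupNamespace` linter flags; the name is mandated.
set_option linter.dupNamespace false

namespace Summit.ValiantsHypothesis.ValiantsHypothesis.Theorems.LacunarySymmetroidMatrixDescartes.Census

/-- **Minimum over a non-empty set of the twenty positions, as a disjunction with numeral indices**: for `x : Fin 20 → ℝ` and a
non-empty `s`, some `i ∈ s` (listed as the numerals `0, …, 19`) has `x i ≤ x j` for all `j ∈ s`. [folklore] -/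
theorem min_cases20_on (s : Finset (Fin 20)) (hs : s.Nonempty) (x : Fin 20 → ℝ) :
    ((0 : Fin 20) ∈ s ∧ ∀ j ∈ s, x 0 ≤ x j) ∨
    ((1 : Fin 20) ∈ s ∧ ∀ j ∈ s, x 1 ≤ x j) ∨
    ((2 : Fin 20) ∈ s ∧ ∀ j ∈ s, x 2 ≤ x j) ∨
    ((3 : Fin 20) ∈ s ∧ ∀ j ∈ s, x 3 ≤ x j) ∨
    ((4 : Fin 20) ∈ s ∧ ∀ j ∈ s, x 4 ≤ x j) ∨
    ((5 : Fin 20) ∈ s ∧ ∀ j ∈ s, x 5 ≤ x j) ∨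
    ((6 : Fin 20) ∈ s ∧ ∀ j ∈ s, x 6 ≤ x j) ∨
    ((7 : Fin 20) ∈ s ∧ ∀ j ∈ s, x 7 ≤ x j) ∨
    ((8 : Fin 20) ∈ s ∧ ∀ j ∈ s, x 8 ≤ x j) ∨
    ((9 : Fin 20) ∈ s ∧ ∀ j ∈ s, x 9 ≤ x j) ∨
    ((10 : Fin 20) ∈ s ∧ ∀ j ∈ s, x 10 ≤ x j) ∨
    ((11 : Fin 20) ∈ s ∧ ∀ j ∈ s, x 11 ≤ x j) ∨
    ((12 : Fin 20) ∈ s ∧ ∀ j ∈ s, x 12 ≤ x j) ∨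
    ((13 : Fin 20) ∈ s ∧ ∀ j ∈ s, x 13 ≤ x j) ∨
    ((14 : Fin 20) ∈ s ∧ ∀ j ∈ s, x 14 ≤ x j) ∨
    ((15 : Fin 20) ∈ s ∧ ∀ j ∈ s, x 15 ≤ x j) ∨
    ((16 : Fin 20) ∈ s ∧ ∀ j ∈ s, x 16 ≤ x j) ∨
    ((17 : Fin 20) ∈ s ∧ ∀ j ∈ s, x 17 ≤ x j) ∨
    ((18 : Fin 20) ∈ s ∧ ∀ j ∈ s, x 18 ≤ x j) ∨
    ((19 : Fin 20) ∈ s ∧ ∀ j ∈ s, x 19 ≤ x j) := by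
  obtain ⟨i, hi, h⟩ := Finset.exists_min_image s x hs
  fin_cases i

  · exact Or.inl ⟨hi, h⟩
  · exact Or.inr (Or.inl ⟨hi, h⟩)
  · exact Or.inr (Or.inr (Or.inl ⟨hi, h⟩))
  · exact Or.inr (Or.inr (Or.inr (Or.inl ⟨hi, h⟩)))
  · exact Or.inr (Or.inr (Or.inr (Or.inr (Or.inl ⟨hi, h⟩))))
  · exact Or.inr (Or.inr (Or.inr (Or.inr (Or.inr (Or.inl ⟨hi, h⟩)))))
  · exact Or.inr (Or.inr (Or.inr (Or.inr (Or.inr (Or.inr (Or.inl ⟨hi, h⟩))))))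
  · exact Or.inr (Or.inr (Or.inr (Or.inr (Or.inr (Or.inr (Or.inr (Or.inl ⟨hi, h⟩)))))))
  · exact Or.inr (Or.inr (Or.inr (Or.inr (Or.inr (Or.inr (Or.inr (Or.inr (Or.inl ⟨hi, h⟩))))))))
  · exact Or.inr (Or.inr (Or.inr (Or.inr (Or.inr (Or.inr (Or.inr (Or.inr (Or.inr (Or.inl ⟨hi, h⟩)))))))))
  · exact Or.inr (Or.inr (Or.inr (Or.inr (Or.inr (Or.inr (Or.inr (Or.inr (Or.inr (Or.inr (Or.inl ⟨hi, h⟩))))))))))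
  · exact Or.inr (Or.inr (Or.inr (Or.inr (Or.inr (Or.inr (Or.inr (Or.inr (Or.inr (Or.inr (Or.inr (Or.inl ⟨hi, h⟩)))))))))))
  · exact Or.inr (Or.inr (Or.inr (Or.inr (Or.inr (Or.inr (Or.inr (Or.inr (Or.inr (Or.inr (Or.inr (Or.inr (Or.inl ⟨hi, h⟩))))))))))))
  · exact Or.inr (Or.inr (Or.inr (Or.inr (Or.inr (Or.inr (Or.inr (Or.inr (Or.inr (Or.inr (Or.inr (Or.inr (Or.inr (Or.inl ⟨hi, h⟩)))))))))))))
  · exact Or.inr (Or.inr (Or.inr (Or.inr (Or.inr (Or.inr (Or.inr (Or.inr (Or.inr (Or.inr (Or.inr (Or.inr (Or.inr (Or.inr (Or.inl ⟨hi, h⟩))))))))))))))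
  · exact Or.inr (Or.inr (Or.inr (Or.inr (Or.inr (Or.inr (Or.inr (Or.inr (Or.inr (Or.inr (Or.inr (Or.inr (Or.inr (Or.inr (Or.inr (Or.inl ⟨hi, h⟩)))))))))))))))
  · exact Or.inr (Or.inr (Or.inr (Or.inr (Or.inr (Or.inr (Or.inr (Or.inr (Or.inr (Or.inr (Or.inr (Or.inr (Or.inr (Or.inr (Or.inr (Or.inr (Or.inl ⟨hi, h⟩))))))))))))))))
  · exact Or.inr (Or.inr (Or.inr (Or.inr (Or.inr (Or.inr (Or.inr (Or.inr (Or.inr (Or.inr (Or.inr (Or.inr (Or.inr (Or.inr (Or.inr (Or.inr (Or.inr (Or.inl ⟨hi, h⟩)))))))))))))))))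
  · exact Or.inr (Or.inr (Or.inr (Or.inr (Or.inr (Or.inr (Or.inr (Or.inr (Or.inr (Or.inr (Or.inr (Or.inr (Or.inr (Or.inr (Or.inr (Or.inr (Or.inr (Or.inr (Or.inl ⟨hi, h⟩))))))))))))))))))
  · exact Or.inr (Or.inr (Or.inr (Or.inr (Or.inr (Or.inr (Or.inr (Or.inr (Or.inr (Or.inr (Or.inr (Or.inr (Or.inr (Or.inr (Or.inr (Or.inr (Or.inr (Or.inr (Or.inr (⟨hi, h⟩)))))))))))))))))))

/-- **Minimum of twenty reals, as a disjunction with numeral indices** (the case `s = univ` of `min_cases20_on`). [folklore] -/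
theorem min_cases20 (x : Fin 20 → ℝ) :
    (∀ j, x 0 ≤ x j) ∨
    (∀ j, x 1 ≤ x j) ∨
    (∀ j, x 2 ≤ x j) ∨
    (∀ j, x 3 ≤ x j) ∨
    (∀ j, x 4 ≤ x j) ∨
    (∀ j, x 5 ≤ x j) ∨
    (∀ j, x 6 ≤ x j) ∨
    (∀ j, x 7 ≤ x j) ∨
    (∀ j, x 8 ≤ x j) ∨
    (∀ j, x 9 ≤ x j) ∨
    (∀ j, x 10 ≤ x j) ∨
    (∀ j, x 11 ≤ x j) ∨
    (∀ j, x 12 ≤ x j) ∨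
    (∀ j, x 13 ≤ x j) ∨
    (∀ j, x 14 ≤ x j) ∨
    (∀ j, x 15 ≤ x j) ∨
    (∀ j, x 16 ≤ x j) ∨
    (∀ j, x 17 ≤ x j) ∨
    (∀ j, x 18 ≤ x j) ∨
    (∀ j, x 19 ≤ x j) := by
  rcases min_cases20_on Finset.univ Finset.univ_nonempty x with
    h | h | h | h | h | h | h | h | h | h | h | h | h | h | h | h | h | h | h | h

  · exact Or.inl (fun j => h.2 j (Finset.mem_univ j))
  · exact Or.inr (Or.inl (fun j => h.2 j (Finset.mem_univ j)))
  · exact Or.inr (Or.inr (Or.inl (fun j => h.2 j (Finset.mem_univ j))))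
  · exact Or.inr (Or.inr (Or.inr (Or.inl (fun j => h.2 j (Finset.mem_univ j)))))
  · exact Or.inr (Or.inr (Or.inr (Or.inr (Or.inl (fun j => h.2 j (Finset.mem_univ j))))))
  · exact Or.inr (Or.inr (Or.inr (Or.inr (Or.inr (Or.inl (fun j => h.2 j (Finset.mem_univ j)))))))
  · exact Or.inr (Or.inr (Or.inr (Or.inr (Or.inr (Or.inr (Or.inl (fun j => h.2 j (Finset.mem_univ j))))))))
  · exact Or.inr (Or.inr (Or.inr (Or.inr (Or.inr (Or.inr (Or.inr (Or.inl (fun j => h.2 j (Finset.mem_univ j)))))))))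
  · exact Or.inr (Or.inr (Or.inr (Or.inr (Or.inr (Or.inr (Or.inr (Or.inr (Or.inl (fun j => h.2 j (Finset.mem_univ j))))))))))
  · exact Or.inr (Or.inr (Or.inr (Or.inr (Or.inr (Or.inr (Or.inr (Or.inr (Or.inr (Or.inl (fun j => h.2 j (Finset.mem_univ j)))))))))))
  · exact Or.inr (Or.inr (Or.inr (Or.inr (Or.inr (Or.inr (Or.inr (Or.inr (Or.inr (Or.inr (Or.inl (fun j => h.2 j (Finset.mem_univ j))))))))))))
  · exact Or.inr (Or.inr (Or.inr (Or.inr (Or.inr (Or.inr (Or.inr (Or.inr (Or.inr (Or.inr (Or.inr (Or.inl (fun j => h.2 j (Finset.mem_univ j)))))))))))))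
  · exact Or.inr (Or.inr (Or.inr (Or.inr (Or.inr (Or.inr (Or.inr (Or.inr (Or.inr (Or.inr (Or.inr (Or.inr (Or.inl (fun j => h.2 j (Finset.mem_univ j))))))))))))))
  · exact Or.inr (Or.inr (Or.inr (Or.inr (Or.inr (Or.inr (Or.inr (Or.inr (Or.inr (Or.inr (Or.inr (Or.inr (Or.inr (Or.inl (fun j => h.2 j (Finset.mem_univ j)))))))))))))))
  · exact Or.inr (Or.inr (Or.inr (Or.inr (Or.inr (Or.inr (Or.inr (Or.inr (Or.inr (Or.inr (Or.inr (Or.inr (Or.inr (Or.inr (Or.inl (fun j => h.2 j (Finset.mem_univ j))))))))))))))))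
  · exact Or.inr (Or.inr (Or.inr (Or.inr (Or.inr (Or.inr (Or.inr (Or.inr (Or.inr (Or.inr (Or.inr (Or.inr (Or.inr (Or.inr (Or.inr (Or.inl (fun j => h.2 j (Finset.mem_univ j)))))))))))))))))
  · exact Or.inr (Or.inr (Or.inr (Or.inr (Or.inr (Or.inr (Or.inr (Or.inr (Or.inr (Or.inr (Or.inr (Or.inr (Or.inr (Or.inr (Or.inr (Or.inr (Or.inl (fun j => h.2 j (Finset.mem_univ j))))))))))))))))))
  · exact Or.inr (Or.inr (Or.inr (Or.inr (Or.inr (Or.inr (Or.inr (Or.inr (Or.inr (Or.inr (Or.inr (Or.inr (Or.inr (Or.inr (Or.inr (Or.inr (Or.inr (Or.inl (fun j => h.2 j (Finset.mem_univ j)))))))))))))))))))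
  · exact Or.inr (Or.inr (Or.inr (Or.inr (Or.inr (Or.inr (Or.inr (Or.inr (Or.inr (Or.inr (Or.inr (Or.inr (Or.inr (Or.inr (Or.inr (Or.inr (Or.inr (Or.inr (Or.inl (fun j => h.2 j (Finset.mem_univ j))))))))))))))))))))
  · exact Or.inr (Or.inr (Or.inr (Or.inr (Or.inr (Or.inr (Or.inr (Or.inr (Or.inr (Or.inr (Or.inr (Or.inr (Or.inr (Or.inr (Or.inr (Or.inr (Or.inr (Or.inr (Or.inr ((fun j => h.2 j (Finset.mem_univ j)))))))))))))))))))))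

/-- **Ratio move of the transport, one line**: `0 < a`, `0 < b`, `a ≤ 2^j · b` give `log a ≤ j · log 2 + log b`. [folklore] -/
theorem log_le_of_le_two_pow_mul {a b : ℝ} {j : ℕ} (ha : 0 < a) (hb : 0 < b) (h : a ≤ (2 : ℝ) ^ j * b) :
    Real.log a ≤ (j : ℝ) * Real.log 2 + Real.log b := by
  have h1 := Real.log_le_log ha h
  rw [Real.log_mul (pow_ne_zero _ two_ne_zero) hb.ne', Real.log_pow] at h1
  exact h1

end Summit.ValiantsHypothesis.ValiantsHypothesis.Theorems.LacunarySymmetroidMatrixDescartes.Census
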